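import Summits.BirchSwinnertonDyer.Rank1Residual.X1.GeneratorCountLayerAtPLocal
import Summits.BirchSwinnertonDyer.Rank1Residual.X1.LocalPackageRatStrictOne
import HarnessLib

/-!
# Route M's generator COUNT at LAYER `n`, X: THE LOCAL TERM `a = 1` AT THE PRIME ABOVE AN
# ANOMALOUS `p` SUPPLIED WITHOUT RATIONAL `p`-TORSION — `p^{#T₀ + 1} ≤ p^{λ + pⁿμ} · (#E[p^∞]^{Γ_ℚ})²`
# (cell `b2b-bsdres`, unit `b2b-bsdres-eisenstein-p1`, gen 21; X1R0-GAPMAP §29–§30, V99)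

HONEST FRAMING (run/shared/lean/b2b/bsd-rank1-residual/, verbatim in every file): the goal of the
cell is to DELETE the COMBINATION-SHAPED residual classes of the Birch–Swinnerton-Dyer formula for
ALL analytic-rank `≤ 1` elliptic curves over `ℚ` — "full BSD formula for every rank `≤ 1` curve in
class `C`" assembled STRICTLY from published theorems — so that the rank-`≤ 1` remainder becomes
exactly the CONSTRUCTION-SHAPED classes, which are TYPED (missing-input `Prop`s), NOT attempted.
This is not "finishing BSD". Sub-cell `b2b-bsdres-eisenstein-p1` (CLASS-OWNERS row "X1 (r = 0)"):
research route; NO CLAIM BEYOND STATED CLASSES; nothing here changes a label; nothing is booked.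
THEOREMS ONLY — no definition, no named fact, no typed input introduced. The PUBLISHED inputs remain
HYPOTHESES exactly as in FILE 24b (`X1/GeneratorCountLayerAtPStrict`) and gen 20's
`X1/GeneratorCountLayerAtPLocal`: Greenberg's Prop. 2.4 (`hGrK`), the Poitou–Tate family over `ℚ_n`
(`inv`, `hperf`, `hsum`, `hcompl`) and Tate's local Euler–Poincaré characteristic at the places of
`ℚ_n` (`hEP`); nothing about any particular curve is asserted.

## What and why

Gen 20 (`GeneratorCountLayerAtPLocal.pow_card_add_two_le_pow_mul_sq`) fed FILE 24b with the local
package of index `p²` at the prime `wp` of `ℚ_n` above `p`, available when `E(ℚ)` has a point of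
order `p`. For the `δ = 0` members of a leaf class (no rational `p`-torsion; at an anomalous prime
`E(ℚ_p)[p]` may still vanish, e.g. `282310u2@3`) the package of gen 21's `X1/LocalStrictPackageOne`
has index `p · #E((ℚ_n)_wp)[p] ≥ p¹` with NO torsion hypothesis — the anomaly (`hs_anom`) is the only
place the rational point was really used, and it is a HYPOTHESIS here (`hanom : p ∣ #Ẽ(𝔽_p)`; on the
leaf `a_p ≡ 1 (mod p)`):

* **`pow_card_add_one_le_pow_mul_sq`**: `p^{#T₀ + 1} ≤ p^{λ(X) + pⁿμ(X)} · (#E[p^∞]^{Γ_ℚ})²`.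

So at every ANOMALOUS good ordinary odd `p` the kernel now has §14.1's `t_n + a − 2δ ≤ λ + pⁿμ` with
`a ≥ 1` for every member and `a = 2` for members with a rational point of order `p` (gen 20); census
consumer: `282310u@3` binds at its `δ = 0`, `μ = 1` member `282310u2` (`t₁ = 7`, `E(ℚ_3)[3] = 0`):
`3 + deg D ≥ 8` kills the degree-`4` candidate (X1R0-GAPMAP §30).

References: [GreenbergLNM1716] §2 Prop. 2.4, §3 Lemma 3.1, Lemma 3.4 (p. 89), §5 pp. 114–118, p. 137;
[MilneADT2006] I Thm. 2.8, Thm. 4.10; [SerreGaloisCohomology1997] II.§1.1; X1R0-GAPMAP §14.1, §26–§30.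
-/

noncomputable section

open scoped Classical NNReal

open Function Field NumberField IsDedekindDomain WeierstrassCurve PowerSeries
  Literature.NumberTheory.EllipticCurves Literature.NumberTheory.GaloisRepresentations
  Literature.NumberTheory.GaloisCohomology Summit.BirchSwinnertonDyer.Rank1Residual.GaloisImage
  Literature.NumberTheory.EllipticCurves.IwasawaAlgebra
  Summit.BirchSwinnertonDyer.Rank1Residual.Additive
  Summit.BirchSwinnertonDyer.Rank1Residual.Additive.ZpTower
  Summit.BirchSwinnertonDyer.Rank1Residual.Additive.LocalTransport
  Summit.BirchSwinnertonDyer.Rank1Residual.X1.GeneratorBoundMuLayer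
open Literature.NumberTheory.GaloisRepresentations.DiscreteGaloisModule (SelmerStructure unramifiedSubgroup)
open Literature.NumberTheory.EllipticCurves.Greenberg1999 (imKummer_ge_strictCondition_goodOrdinary)
open Literature.NumberTheory.EllipticCurves.GreenbergSelmer (inertiaIn inertiaInToH)
open Summit.BirchSwinnertonDyer.Rank1Residual.X2.GreenbergVatsalReductionDatum (localRed)

set_option autoImplicit false

namespace Summit.BirchSwinnertonDyer.Rank1Residual.X1.GeneratorCountLayerAtPLocalOne

variable (W : WeierstrassCurve ℚ) [W.IsElliptic] [W.IsGloballyMinimal] {p : ℕ} [hp : Fact p.Prime]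
  (κ : ZpExtension ℚ p) (n : ℕ) (κn : ZpExtension (κ.layer n) p)
  (hκn : ∀ σ : Field.absoluteGaloisGroup (κ.layer n),
    (κn σ).toAdd * (p : ℤ_[p]) ^ n = (κ (resGal (K := ℚ) (κ.layer n) σ)).toAdd)
  {γ : Field.absoluteGaloisGroup ℚ} (D : W.SelmerDualData κ γ)

/-! ## The layer-`n` count with the local term `a = 1` at an anomalous prime (no rational `p`-torsion) -/

set_option maxHeartbeats 400000 in -- the `K`-general factorisation data are matched against the
-- `ℚ`-level package hypotheses through the two `Algebra ℚ ℚ_n` instance paths (defeq beyond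
-- `instances` transparency only); each such unification is expensive.
include hκn in
/-- **ROUTE M AT LAYER `n`, LOCAL TERM `a = 1` SUPPLIED AT AN ANOMALOUS PRIME**:
`p^{#T₀ + 1} ≤ p^{λ(X) + pⁿμ(X)} · (#E[p^∞]^{Γ_ℚ})²`. `E/ℚ` globally minimal, `p` odd with
`p ∤ Δ_E`, `p ∤ a_p` and `p ∣ #Ẽ(𝔽_p)` (ANOMALOUS; no rational point of order `p` assumed); `κ`
cyclotomic with layer `ℚ_n` and restricted tower `κ_n`; `D` any dual datum of `Sel_{p^∞}(E/ℚ_∞)`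
with `X` finitely generated torsion without non-zero finite submodules; a Poitou–Tate family and
Tate's local Euler–Poincaré characteristic over `ℚ_n`; `T₀` places `w ∤ p` of `ℚ_n` with Tamagawa
witnesses; Greenberg's Prop. 2.4 BY NAME (`hGrK`). FILE 24b with the `e = 1` local package
(`X1/LocalPackageRatOne`, `X1/LocalPackageRatStrictOne`, gen 20's factorisation) at the prime of
`ℚ_n` above `p` DISCHARGED. For members WITHOUT rational `p`-torsion `#E[p^∞]^{Γ_ℚ} = 1` and this is
X1R0-GAPMAP §14.1's `t_n + 1 ≤ λ + pⁿμ` (the guaranteed part of the local term `a` at `δ = 0`).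
[cite: GreenbergLNM1716, §2 Prop. 2.4, §3 Lemma 3.1, Lemma 3.4 (p. 89), §5 pp. 114–118, p. 137]
[cite: MilneADT2006, I Thm. 2.8] -/
theorem pow_card_add_one_le_pow_mul_sq [Module.Finite (IwasawaAlgebra p) D.X]
    (hgood : W.HasGoodReductionAtPrime p)
    (hX : D.IsTorsion) (hnf : ∀ N : Submodule (IwasawaAlgebra p) D.X, Finite N → N = ⊥)
    (hodd : p ≠ 2) (hκ : κ.IsCyclotomic) (hGrK : imKummer_ge_strictCondition_goodOrdinary)
    (v : HeightOneSpectrum (𝓞 ℚ)) (hpv : ((p : ℕ) : 𝓞 ℚ) ∈ v.asIdeal)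
    (hΔ : ¬ (p : ℤ) ∣ minimalDiscriminantInt W) (hord : ¬ (p : ℤ) ∣ W.frobeniusTrace p)
    (hanom : p ∣ W.reductionPointCount p)
    (inv : LocalInvariants (κ.layer n) p) (hperf : inv.IsPerfect) (hsum : inv.SumLocalTermEqZero)
    (hcompl : inv.SelmerComplement)
    (hEP : ∀ w : HeightOneSpectrum (𝓞 (κ.layer n)),
      localEulerPoincareCharacteristic (w.adicCompletion (κ.layer n)))
    (T₀ : Finset (HeightOneSpectrum (𝓞 (κ.layer n))))
    (hT₀p : ∀ w ∈ T₀, ((p : ℕ) : 𝓞 (κ.layer n)) ∉ w.asIdeal)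
    (hwit : ∀ w ∈ T₀, ∃ u ∈ unramifiedSubgroup
        (((W.baseChange (κ.layer n)).torsionGaloisModule (p : ℤ)).restrictField
          (w.adicCompletion (κ.layer n))) 1,
      u ∉ (W.baseChange (κ.layer n)).kummerLocalConditionAt (p : ℤ) (w.adicCompletion (κ.layer n))) :
    p ^ (T₀.card + 1) ≤ p ^ (lambdaInvariant p D.X + p ^ n * muInvariant p D.X) *
      Nat.card (MulAction.fixedPoints (Field.absoluteGaloisGroup ℚ) (geomPrimaryTorsion W p)) ^ 2 := by
  have hfact := GeneratorCountLayerAtPLocal.exists_factorisation κ n v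
  obtain ⟨wp, hwp, ι₂, ι', τ, hι₂, hcompat, hfix, hτ⟩ := hfact
  -- (the `LiesOver` instance restated at `ℚ`: the factorisation lemma is `K`-general, and its
  -- `Algebra ℚ ℚ_n` is the layer's `IntermediateField.algebra`, not `DivisionRing.toRatAlgebra`)
  haveI hwpv : wp.asIdeal.LiesOver v.asIdeal := hwp
  have hpack := LocalPackageRatStrictOne.exists_strict_addSubgroup_one W κ n κn hκn hpv hΔ wp ι₂
    hι₂ ι' hcompat hfix τ hτ hκ hodd hord hanom (hEP wp)
  obtain ⟨𝓛wp, h𝓛, hidx, hstr⟩ := hpack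
  -- `wp ∋ p`, so `wp ∉ T₀`
  have hpw : ((p : ℕ) : 𝓞 (κ.layer n)) ∈ wp.asIdeal := by
    have h1 : (algebraMap (𝓞 ℚ) (𝓞 (κ.layer n))) ((p : ℕ) : 𝓞 ℚ) ∈ wp.asIdeal := by
      rw [← Ideal.mem_comap]
      have h2 : v.asIdeal = wp.asIdeal.comap (algebraMap (𝓞 ℚ) (𝓞 (κ.layer n))) :=
        Ideal.LiesOver.over
      rw [← h2]; exact hpv
    rwa [map_natCast] at h1
  have hwpT₀ : wp ∉ T₀ := fun h ↦ hT₀p wp h hpw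
  -- the family of local conditions: `𝓛wp` at `wp` (FILE 24b uses no other place of the family)
  let 𝓛 : ∀ w : HeightOneSpectrum (𝓞 (κ.layer n)), AddSubgroup (galoisCohomology
      (((W.baseChange (κ.layer n)).torsionGaloisModule (p : ℤ)).toLocal (Sum.inr w)) 1) :=
    Function.update (fun _ ↦ ⊤) wp
      (show AddSubgroup (galoisCohomology (((W.baseChange (κ.layer n)).torsionGaloisModule
        (p : ℤ)).toLocal (Sum.inr wp)) 1) from 𝓛wp)
  have h𝓛wp : 𝓛 wp = (show AddSubgroup (galoisCohomology (((W.baseChange (κ.layer n)).torsionGaloisModule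
        (p : ℤ)).toLocal (Sum.inr wp)) 1) from 𝓛wp) := Function.update_self _ _ _
  refine GeneratorCountLayerAtPStrict.pow_card_add_le_pow_mul_sq_of_strict_of_ordinary W κ n κn hκn D
    hgood hX hnf hodd hκ hGrK v hpv hΔ hord inv hperf hsum hcompl hEP T₀ hT₀p hwit wp hwpT₀ hwpv 𝓛
    (by rw [h𝓛wp]; exact h𝓛) 1 (by rw [h𝓛wp]; exact hidx) fun y hy ↦ ?_
  obtain ⟨φ, rfl⟩ := oneCocycleClass_surjective _ y
  rw [h𝓛wp] at hy
  exact ⟨φ, rfl, hstr φ hy⟩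

end Summit.BirchSwinnertonDyer.Rank1Residual.X1.GeneratorCountLayerAtPLocalOne

end
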